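import Summits.MatrixMultiplication.OmegaCensus.STPP222PowFromCardPoly
import Summits.MatrixMultiplication.OmegaCensus.STPP222PowCyclicThreeAPFree

/-!
# ω-census, STPP law `(2,2,2)^k`: the uniform threshold is `O(k² · 9^{⌈log₂ k⌉}) = O(k^{5.17})`

HONEST FRAMING (pub-omega census; verbatim): lottery ticket; floor = certified bounds/negative ranges.
Census STRUCTURE bookkeeping (STRUCTURE Q7, the uniform threshold `N_k`), not progress on `ω`.

`STPP222PowFromCardPoly.lean` proves `N_k ≤ 10k²(8k²+8)²` from the QUADRATIC exponent law; the same three-block argument with the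
explicit base-3 exponent law `exists_isSTPP_222pow_of_exponent_ge_two_pow` (`STPP222PowCyclicThreeAPFree.lean`: exponent `≥ 8·3^t`
gives `(2,2,2)^k` for `k ≤ 2^t`) yields

* `exists_isSTPP_222pow_of_card_ge_poly3` — **for all `t`, all `k ≤ 2^t`, every finite abelian group of order `≥ 640·k²·9^t` admits
  `(2,2,2)^k`**; with `t = ⌈log₂ k⌉`: `N_k ≤ 640k²·9^{⌈log₂k⌉} < 5760·k^{2+2log₂3} ≈ 5760·k^{5.17}` (for `k = 16`: `2.7·10⁹` vs `1.08·10¹⁰`).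

No sharpness claimed.  [cite: CohnKleinbergSzegedyUmans2005, Def. 5.1]  Seat pub-omega-stpp-3 (gen 10), 2026-08-24.
(Filing note: both imports were landed on 2026-08-24 and had no farm olean that evening; file once `lean check` stops reporting them unbuilt.)
-/

open Literature.Computability.AlgebraicComplexity Literature.Combinatorics.Additive Finset

namespace Summit.MatrixMultiplication.OmegaCensus

/-- **Every finite abelian group of order `≥ 640·k²·9^t` admits `(2,2,2)^k` whenever `k ≤ 2^t`** (three greedy blocks of
`Π ℤ/qᵢ` as in `exists_isSTPP_222pow_of_card_ge_poly`, with the factor bound `E = 8·3^t` from the base-3 cyclic law).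
[cite: CohnKleinbergSzegedyUmans2005, Def. 5.1] -/
theorem exists_isSTPP_222pow_of_card_ge_poly3 (t k : ℕ) (hk : k ≤ 2 ^ t) {G : Type*} [AddCommGroup G] [Finite G]
    (hG : 640 * k ^ 2 * 9 ^ t ≤ Nat.card G) :
    ∃ A B C : Fin k → Finset G, IsSTPP A B C ∧ ∀ i, (A i).card = 2 ∧ (B i).card = 2 ∧ (C i).card = 2 := by
  classical
  rcases Nat.eq_zero_or_pos k with hk0 | hk1
  · subst hk0
    exact ⟨fun _ => ∅, fun _ => ∅, fun _ => ∅, fun i => i.elim0, fun i => i.elim0⟩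
  by_cases hexp : 8 * 3 ^ t ≤ AddMonoid.exponent G
  · exact exists_isSTPP_222pow_of_exponent_ge_two_pow t k hk hexp
  push Not at hexp
  set E : ℕ := 8 * 3 ^ t with hEdef
  have h3t : 1 ≤ 3 ^ t := Nat.one_le_pow _ _ (by norm_num)
  have hE2 : 2 ≤ E := by omega
  have hE9 : E ^ 2 = 64 * 9 ^ t := by
    rw [hEdef, mul_pow, ← pow_mul, show (3 : ℕ) ^ (t * 2) = 9 ^ t by rw [mul_comm, pow_mul]; norm_num]
    norm_num
  obtain ⟨ι, _, q, hq0, hdvd, hcard, ⟨f⟩⟩ := exists_addEquiv_pi_zmod G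
  haveI : ∀ i, NeZero (q i) := fun i => ⟨(hq0 i).ne'⟩
  have hexppos : 0 < AddMonoid.exponent G := Nat.pos_of_ne_zero AddMonoid.exponent_ne_zero_of_finite
  have hq1 : ∀ i, 1 ≤ q i := hq0
  have hqE : ∀ i, q i ≤ E := fun i => by
    have h1 := Nat.le_of_dvd hexppos (hdvd i)
    omega
  have hk2 : k ≤ k ^ 2 := by nlinarith
  have hN : 10 * k ^ 2 * E ^ 2 ≤ ∏ i, q i := by
    rw [hcard, hE9]
    calc 10 * k ^ 2 * (64 * 9 ^ t) = 640 * k ^ 2 * 9 ^ t := by ring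
      _ ≤ Nat.card G := hG
  have h10 : 10 ≤ ∏ i, q i := le_trans (by nlinarith) hN
  obtain ⟨t₁, -, ht1a, ht1b⟩ :=
    exists_subset_prod_window q (T := 10) (M := E) (by norm_num) hE2 hq1 hqE univ h10
  have hsplit1 : (∏ i ∈ t₁, q i) * ∏ i ∈ t₁ᶜ, q i = ∏ i, q i := Finset.prod_mul_prod_compl t₁ q
  have hP1 : k ^ 2 * E ≤ ∏ i ∈ t₁ᶜ, q i := by
    by_contra hlt
    push Not at hlt
    have hpos : 0 < ∏ i ∈ t₁, q i := by omega
    have h1 : (∏ i ∈ t₁, q i) * ∏ i ∈ t₁ᶜ, q i < (∏ i ∈ t₁, q i) * (k ^ 2 * E) :=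
      (Nat.mul_lt_mul_left hpos).2 hlt
    have h2 : (∏ i ∈ t₁, q i) * (k ^ 2 * E) ≤ 10 * E * (k ^ 2 * E) := Nat.mul_le_mul_right _ ht1b.le
    rw [hsplit1] at h1
    nlinarith
  let q₁ : {i // i ∉ t₁} → ℕ := fun j => q j.1
  have hprod1 : ∏ j, q₁ j = ∏ i ∈ t₁ᶜ, q i :=
    (Finset.prod_subtype t₁ᶜ (fun x => by rw [Finset.mem_compl]) q).symm
  obtain ⟨t₂, -, ht2a, ht2b⟩ :=
    exists_subset_prod_window q₁ (T := k) (M := E) hk1 hE2 (fun j => hq1 j.1) (fun j => hqE j.1) univ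
      (by rw [hprod1]; exact le_trans (le_trans hk2 (Nat.le_mul_of_pos_right _ (by omega))) hP1)
  have hsplit2 : (∏ j ∈ t₂, q₁ j) * ∏ j ∈ t₂ᶜ, q₁ j = ∏ j, q₁ j := Finset.prod_mul_prod_compl t₂ q₁
  have hP3 : k ≤ ∏ j ∈ t₂ᶜ, q₁ j := by
    by_contra hlt
    push Not at hlt
    have hpos : 0 < ∏ j ∈ t₂, q₁ j := by omega
    have h1 : (∏ j ∈ t₂, q₁ j) * ∏ j ∈ t₂ᶜ, q₁ j < (∏ j ∈ t₂, q₁ j) * k := (Nat.mul_lt_mul_left hpos).2 hlt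
    have h2 : (∏ j ∈ t₂, q₁ j) * k ≤ k * E * k := Nat.mul_le_mul_right _ ht2b.le
    rw [hsplit2, hprod1] at h1
    nlinarith
  have hK1 : ∃ A B C : Fin 1 → Finset (Π i : {i // i ∈ t₁}, ZMod (q i)), IsSTPP A B C ∧
      ∀ i, (A i).card = 2 ∧ (B i).card = 2 ∧ (C i).card = 2 :=
    exists_isSTPP_222one_of_card (by rw [natCard_pi_zmod_mem]; exact ht1a)
  obtain ⟨σ, τ, υ, hT⟩ := exists_isTSF_prod_of_le_card
    (K₂ := Π j : {j : {i // i ∉ t₁} // j ∈ t₂}, ZMod (q₁ j)) (K₃ := Π j : {j : {i // i ∉ t₁} // j ∉ t₂}, ZMod (q₁ j))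
    (k := k) (by rw [natCard_pi_zmod_mem]; exact ht2a) (by rw [natCard_pi_zmod_not_mem]; exact hP3)
  have h12 := exists_isSTPP_222pow_mul_of_tsf hK1 hT
  rw [one_mul] at h12
  obtain ⟨φ₂, hφ₂⟩ := exists_prodPi_injective (fun j : {i // i ∉ t₁} => ZMod (q₁ j)) t₂
  obtain ⟨φ₁, hφ₁⟩ := exists_prodPi_injective (fun i => ZMod (q i)) t₁
  have h3 := exists_isSTPP_222pow_of_injective ((AddMonoidHom.id _).prodMap φ₂)
    (Function.injective_id.prodMap hφ₂) h12
  have h4 := exists_isSTPP_222pow_of_injective φ₁ hφ₁ h3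
  exact exists_isSTPP_222pow_of_injective f.symm.toAddMonoidHom f.symm.injective h4

end Summit.MatrixMultiplication.OmegaCensus
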